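import Mathlib
import Summits.QuantumFields.Balaban3D.Carriers.Series
import Summits.QuantumFields.Balaban3D.Proofs.OldTermsCount
import Summits.QuantumFields.Balaban3D.Proofs.Thresholds

/-!
# `Summit.QuantumFields.Balaban3D.Proofs.Bound46Series` — lane «pub-balaban3d» (Bałaban, CMP **102** (1985) 255–275, d = 3 lattice
# UV stability AS PRINTED), prover seat p2: the interaction bound **(46)** p. 267 for the SERIES TOWER `(B.withSeries 𝔖 Cp).tower3`
# of the lane's expansion data (seat p1 `Carriers.StepSeries`/`Carriers.Series`, rulings R-FL (ii) / R-44) — LEAF-LEDGER row B15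

HONEST FRAMING (lane PLAN.md §0).  [B10] = [Balaban1985UV3]; nothing of the paper is asserted.  At scale `k+1` the tower's interaction
sum is `Pint (k+1) h U = PoldIn_k h U + PY_k h U + PYZ_k h U` (p1 `withSeries_Pint_succ`, `rfl`): the OLD SLICE `PoldIn_k` = the (43)-indexed
sum over p1's index geometry `Carriers.OldTerms` (dropped terms «Y_j ⊄ Ω_{k+1}» replaced by `0`), and the NEWBORN SLICE `PY_k + PYZ_k` =
print's «Σ_Y 𝒫_{k+1}(g_k, Y, U_{k+1})» of (33)/(60) and of (61) — DATA reals of the series (R-ACT).  This file PROVES, kernel-checked: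
* §1 the one-bond sum `hZ` of LQB `bound45_of_bound44` on p1's geometry at full rate (seat p5's torus count `bondSum_le`);
* §2 the volume `|Ω_{k+1}^{(k+1)}(h)|` = p1's `LamVol (k+1) h` = `#Carriers.LamFin k h` (`LamVol_succ_eq_card_lamFin`, R-LAMVOL; print's
  top-scale `Λ_{k+1}`, (42) p. 266); the block count «(M₁L^jη)^{−3}|Λ|» (p. 267 L10) is seat p5's `card_newSites_le` BY NAME (C-B10-1);
* §3 **the old slice of (46)** from the display (44) about `oldVal` (the SAME binder as seat p5's C10, ruling R-44), the degree floor
  «n ≥ 2» and the smallness of (45): `|PoldIn_k h U| ≤ 2C(8L²B₃Z′)²·L⁴/(L−1)·(g_kp(g_k))²·|Ω_{k+1}^{(k+1)}(h)|` (LQB `bound45_of_bound44`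
  per block + the d = 3 power counting `Σ_j L^{−(k−j)} ≤ L/(L−1)`, `B10.powerCounting_d3`);
* §4 **(46) for the series tower** given ONE further named input `hnew` (the newborn slice «|PY_k + PYZ_k| ≤ C_new·(g_kp(g_k))²·
  |Ω_{k+1}^{(k+1)}|», (34) p. 264 / (61) p. 271; owner per lead), and the `LeafSystem.bound46` shape modulo the volume identification
  `hΛ : #LamFin ≤ Λvol (k+1) h` (ruling R-LAMVOL: true once p1's `LamVol` counts `Ω_k^{(k)}`).
-/

noncomputable section
namespace Summit.QuantumFields.Balaban3D.Proofs.Bound46Series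

open Literature.MathematicalPhysics.QuantumFieldTheory.Balaban1983to89
open Literature.MathematicalPhysics.QuantumFieldTheory.Balaban1985CMP102
open Literature.MathematicalPhysics.QuantumFieldTheory.Balaban1985CMP102.Setting
open Summit.QuantumFields.Balaban3D.Carriers
open B10SectCExpansion (VertexGeometry Bound44 Bound45 blockSum45 blockSum45_nonneg bound45_of_bound44)
open Summit.QuantumFields.Balaban3D.Proofs (bondSum_le card_newSites_le sum_Icc_pow_sub)
open Summit.QuantumFields.Balaban3D.Proofs.Thresholds (gammaOf gammaOf_spec)
open Finset

variable {L : ℕ} {S : Scales L} {G : Type} [GaugeGroup G] [MeasurableSpace G] [HaarData G]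

/-! ## §1 The one-bond sum of (45) on p1's torus geometry, full rate -/

/-- **`hZ` of LQB `bound45_of_bound44` AT THE CONCRETE GEOMETRY** `oldGeom S.P k j` (`dist = ℓ_j·tdist`): the one-bond sum
`Σ_b exp(−κ₁(M₁ℓ_j)⁻¹dist(b₋,y₀))·ℓ_j⁻¹dist(b₋,y₀) = Σ_b e^{−(κ₁/M₁)|b₋−y₀|}|b₋−y₀|` over ANY bond set is at most seat p5's torus
constant `Z′(κ₁/M₁)`, `Z′(a) = (2/a)·24·S(a/2)`, `S(κ) = 48/κ³·e^{κ/2}/(1−e^{−κ/2})`. [cite: Balaban1985UV3, (45) p.267] -/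
theorem bondSum45_le {M₁ : ℕ} (hM : 0 < M₁) {κ₁ : ℝ} (hκ₁ : 0 < κ₁) (k j : ℕ) (s : Finset (PBond S.P j)) (y₀ : Site S.P j) :
    ∑ b ∈ s, Real.exp (-(κ₁ * ((M₁ : ℝ) * ell S.P k j)⁻¹ * (oldGeom S.P k j).dist ((oldGeom S.P k j).cminus b) y₀)) *
        ((ell S.P k j)⁻¹ * (oldGeom S.P k j).dist ((oldGeom S.P k j).cminus b) y₀) ≤
      2 / (κ₁ / M₁) * (24 * (48 / (κ₁ / M₁ / 2) ^ 3 * Real.exp (κ₁ / M₁ / 2 / 2) /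
        (1 - Real.exp (-(κ₁ / M₁ / 2 / 2)))) * 1) := by
  have hM' : (0 : ℝ) < M₁ := by exact_mod_cast hM
  have ha : 0 < κ₁ / (M₁ : ℝ) := div_pos hκ₁ hM'
  have hℓ : ell S.P k j ≠ 0 := (ell_pos S.P k j).ne'
  refine le_of_eq_of_le (sum_congr rfl fun b _ => ?_) (bondSum_le (P := S.P) rfl s y₀ ha)
  show Real.exp (-(κ₁ * ((M₁ : ℝ) * ell S.P k j)⁻¹ * (ell S.P k j * (Site.tdist b.src y₀ : ℝ)))) *
      ((ell S.P k j)⁻¹ * (ell S.P k j * (Site.tdist b.src y₀ : ℝ))) =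
      Real.exp (-(κ₁ / M₁ * (Site.tdist b.src y₀ : ℝ))) * (Site.tdist b.src y₀ : ℝ)
  have h1 : κ₁ * ((M₁ : ℝ) * ell S.P k j)⁻¹ * (ell S.P k j * (Site.tdist b.src y₀ : ℝ)) =
      κ₁ / M₁ * (Site.tdist b.src y₀ : ℝ) := by
    field_simp
  have h2 : (ell S.P k j)⁻¹ * (ell S.P k j * (Site.tdist b.src y₀ : ℝ)) = (Site.tdist b.src y₀ : ℝ) := by
    field_simp
  rw [h1, h2]

/-! ## §2 (volume) p1's `LamVol (k+1) h = #LamFin k h` is `Carriers.LamVol_succ_eq_card_lamFin` (Regions v1.3c, ruling R-LAMVOL) -/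

/-! ## §3 The old slice of (46): `|PoldIn_k| ≤ C_old·(g_kp(g_k))²·|Ω_{k+1}^{(k+1)}(h)|` from the display (44) -/

section OldSlice

variable {V : Type} [NormedAddCommGroup V] [NormedSpace ℂ V] {Nc : ℕ → ℕ} [∀ k, NeZero (Nc k)]
  (B : TowerBase S G) (𝔖 : ∀ k, StepSeries S G V (Nc k) k) (k : ℕ)

/-- Triangle inequality: `|PoldIn_k|` is dominated by LQB's block sums `blockSum45` of the RETAINED term model
`PU_j y n c := if Drop then 0 else oldVal h U j y n c` on p1's index sets. [cite: Balaban1985UV3, (43) p.266 + (45) p.267] -/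
theorem abs_poldIn_le_blockSums (h : Hist S.P (k + 1)) (U : GaugeField S.P (k + 1) G) :
    |(𝔖 k).PoldIn B.M₁ B.Rcol h U| ≤ ∑ j ∈ Icc 1 k, ∑ y ∈ oldBlocks B.M₁ B.Rcol h j,
      blockSum45 (oldGeom S.P k j)
        (fun y n c => if Drop B.M₁ B.Rcol h j y n c then 0 else (𝔖 k).oldVal h U j y n c)
        (fun y => oldBonds B.M₁ B.Rcol h j y) ((𝔖 k).Ndeg j) y := by
  unfold StepSeries.PoldIn oldSumIn blockSum45
  refine (abs_sum_le_sum_abs _ _).trans (sum_le_sum fun j _ => ?_)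
  refine (abs_sum_le_sum_abs _ _).trans (sum_le_sum fun y _ => ?_)
  refine (abs_sum_le_sum_abs _ _).trans (sum_le_sum fun n _ => ?_)
  exact abs_sum_le_sum_abs _ _

/-- Blocks outside `Ω_{k+1}(h)^{(j)}` contribute nothing: every term there is DROPPED. [cite: Balaban1985UV3, p.272 L29–31] -/
theorem blockSum45_eq_zero_of_not_mem (h : Hist S.P (k + 1)) (U : GaugeField S.P (k + 1) G) {j : ℕ} {y : Site S.P j}
    (hy : y ∉ newSites B.M₁ B.Rcol h j) :
    blockSum45 (oldGeom S.P k j)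
        (fun y n c => if Drop B.M₁ B.Rcol h j y n c then 0 else (𝔖 k).oldVal h U j y n c)
        (fun y => oldBonds B.M₁ B.Rcol h j y) ((𝔖 k).Ndeg j) y = 0 := by
  unfold blockSum45
  refine sum_eq_zero fun n _ => sum_eq_zero fun c _ => ?_
  have hd : Drop B.M₁ B.Rcol h j y n c := Or.inl hy
  simp only [if_pos hd, abs_zero]

/-- **THE OLD SLICE OF (46) AT THE SERIES' DATA** (pp. 266–267, (44) ⇒ (45) ⇒ (46) for the previous-scale terms `j ≤ k` retained in
`Ω_{k+1}`): from the display (44) about `oldVal` with the coupling factor `g_kp(g_k)` of `U_{k+1}` (`h44` — seat p5's binder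
verbatim), the degree floor «n ≥ 2» (`hfloor`) and the smallness `8L²B₃Z′(κ₁/M₁)·g_kp(g_k) ≤ ½` («for g_{k−1} sufficiently small»),
`|PoldIn_k h U| ≤ 2C·(8L²B₃Z′)²·(L⁴/(L−1))·(g_kp(g_k))²·#LamFin M₁ Rcol k h`.  Standing range `k + 1 ≤ m + K`; `0 < g_k ≤ 1`,
`b₀ ≥ 0`, `C, B₃ ≥ 0`, `κ₁ > 0`, `M₁ ≥ 1`. [cite: Balaban1985UV3, (44)–(46) p.267] -/
theorem abs_poldIn_le (hk : k + 1 ≤ S.m + S.K) {κ₁ B₃ C : ℝ} (hC : 0 ≤ C) (hB : 0 ≤ B₃) (hκ₁ : 0 < κ₁)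
    (hM : 0 < B.M₁) (hb₀ : 0 ≤ B.b₀) (hg : 0 < S.gk k) (hg1 : S.gk k ≤ 1)
    (h44 : ∀ (h : Hist S.P (k + 1)) (U : GaugeField S.P (k + 1) G), ∀ j ∈ Icc 1 k,
      Bound44 (oldGeom S.P k j) (fun y n c => (𝔖 k).oldVal h U j y n c) κ₁ (B.M₁ : ℝ) (ell S.P k j) (L : ℝ) B₃
        (S.gk k) (B10.pFun B.b₀ B.p₀ (S.gk k)) C)
    (hfloor : ∀ (h : Hist S.P (k + 1)) (U : GaugeField S.P (k + 1) G), ∀ j ∈ Icc 1 k, ∀ (y : Site S.P j) (n : ℕ)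
      (c : Fin n → PBond S.P j), (𝔖 k).oldVal h U j y n c ≠ 0 → 2 ≤ n)
    (hsmall : 8 * (L : ℝ) ^ 2 * B₃ *
        (2 / (κ₁ / B.M₁) * (24 * (48 / (κ₁ / B.M₁ / 2) ^ 3 * Real.exp (κ₁ / B.M₁ / 2 / 2) /
          (1 - Real.exp (-(κ₁ / B.M₁ / 2 / 2)))) * 1)) *
        S.gk k * B10.pFun B.b₀ B.p₀ (S.gk k) ≤ 1 / 2)
    (h : Hist S.P (k + 1)) (U : GaugeField S.P (k + 1) G) :
    |(𝔖 k).PoldIn B.M₁ B.Rcol h U| ≤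
      2 * C * (8 * (L : ℝ) ^ 2 * B₃ *
          (2 / (κ₁ / B.M₁) * (24 * (48 / (κ₁ / B.M₁ / 2) ^ 3 * Real.exp (κ₁ / B.M₁ / 2 / 2) /
            (1 - Real.exp (-(κ₁ / B.M₁ / 2 / 2)))) * 1))) ^ 2 *
        ((L : ℝ) ^ 4 / ((L : ℝ) - 1)) * (S.gk k * B10.pFun B.b₀ B.p₀ (S.gk k)) ^ 2 * (LamFin B.M₁ B.Rcol k h).card := by
  classical
  -- abbreviations
  set Z' : ℝ := 2 / (κ₁ / B.M₁) * (24 * (48 / (κ₁ / B.M₁ / 2) ^ 3 * Real.exp (κ₁ / B.M₁ / 2 / 2) /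
    (1 - Real.exp (-(κ₁ / B.M₁ / 2 / 2)))) * 1) with hZ'def
  set g : ℝ := S.gk k with hgdef
  set pg : ℝ := B10.pFun B.b₀ B.p₀ (S.gk k) with hpgdef
  set Λ : ℝ := ((LamFin B.M₁ B.Rcol k h).card : ℝ) with hΛdef
  let PU : (j : ℕ) → Site S.P j → (n : ℕ) → (Fin n → PBond S.P j) → ℝ :=
    fun j y n c => if Drop B.M₁ B.Rcol h j y n c then 0 else (𝔖 k).oldVal h U j y n c
  have hM' : (0 : ℝ) < B.M₁ := by exact_mod_cast hM
  have hL1 : (1 : ℝ) < L := by exact_mod_cast S.hL.2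
  have hL0 : (0 : ℝ) < L := by linarith
  have hpg : 0 ≤ pg := B10.pFun_nonneg _ _ _ hb₀ hg hg1
  have hZ'0 : 0 ≤ Z' := by
    rw [hZ'def]
    have ha : 0 < κ₁ / (B.M₁ : ℝ) := by positivity
    have h1 : Real.exp (-(κ₁ / B.M₁ / 2 / 2)) < 1 := Real.exp_lt_one_iff.2 (by linarith)
    have h2 : 0 < 1 - Real.exp (-(κ₁ / B.M₁ / 2 / 2)) := by linarith
    positivity
  have hCM0 : 0 ≤ 8 * (L : ℝ) ^ 2 * B₃ * Z' := by positivity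
  -- (45) per block, at every old scale j
  have h45 : ∀ j ∈ Icc 1 k, Bound45 (oldGeom S.P k j)
      (blockSum45 (oldGeom S.P k j) (PU j) (fun y => oldBonds B.M₁ B.Rcol h j y) ((𝔖 k).Ndeg j))
      (8 * (L : ℝ) ^ 2 * B₃ * Z') g pg (ell S.P k j) (2 * C) := by
    intro j hj
    refine bound45_of_bound44 (oldGeom S.P k j) (PU j) (fun y => oldBonds B.M₁ B.Rcol h j y) ((𝔖 k).Ndeg j)
      (κ₁ := κ₁) (M₁ := (B.M₁ : ℝ)) hC (ell_pos S.P k j) hB hg.le hpg (oldGeom_dist_nonneg S.P k j) ?_ ?_ ?_ ?_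
    · -- (44) for the retained model: dropped terms are 0, the others are oldVal
      intro y n c
      by_cases hd : Drop B.M₁ B.Rcol h j y n c
      · have : PU j y n c = 0 := if_pos hd
        rw [this, abs_zero]
        refine mul_nonneg hC (prod_nonneg fun i _ => mul_nonneg (Real.exp_pos _).le (mul_nonneg ?_ ?_))
        · exact mul_nonneg (inv_nonneg.mpr (ell_pos S.P k j).le) (oldGeom_dist_nonneg S.P k j _ _)
        · have := hg.le; positivity
      · have : PU j y n c = (𝔖 k).oldVal h U j y n c := if_neg hd
        rw [this]
        exact h44 h U j hj y n c
    · intro y n c hne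
      by_cases hd : Drop B.M₁ B.Rcol h j y n c
      · exact absurd (if_pos hd : PU j y n c = 0) hne
      · exact hfloor h U j hj y n c (by rwa [show PU j y n c = (𝔖 k).oldVal h U j y n c from if_neg hd] at hne)
    · intro y₀
      rw [hZ'def]
      exact bondSum45_le hM hκ₁ k j _ y₀
    · have h1 : ell S.P k j ^ 2 ≤ 1 := by
        have := ell_pos S.P k j
        have hle : ell S.P k j ≤ 1 := by
          unfold ell
          exact pow_le_one₀ (inv_nonneg.mpr (by exact_mod_cast S.P.L_pos.le))
            (inv_le_one_of_one_le₀ (by exact_mod_cast S.hL.2.le))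
        exact pow_le_one₀ this.le hle
      have h0 : 0 ≤ 8 * (L : ℝ) ^ 2 * B₃ * Z' * g * pg := by have := hg.le; positivity
      calc 8 * (L : ℝ) ^ 2 * B₃ * Z' * g * pg * ell S.P k j ^ 2 ≤ 8 * (L : ℝ) ^ 2 * B₃ * Z' * g * pg * 1 :=
            mul_le_mul_of_nonneg_left h1 h0
        _ ≤ 1 / 2 := by rw [mul_one]; exact hsmall
  -- per scale: restrict to the blocks inside Ω_{k+1}, count them
  have hscale : ∀ j ∈ Icc 1 k, ∑ y ∈ oldBlocks B.M₁ B.Rcol h j,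
      blockSum45 (oldGeom S.P k j) (PU j) (fun y => oldBonds B.M₁ B.Rcol h j y) ((𝔖 k).Ndeg j) y ≤
        (L : ℝ) ^ 3 * (L : ℝ)⁻¹ ^ (k - j) * (2 * C * ((8 * (L : ℝ) ^ 2 * B₃ * Z') * g * pg) ^ 2 * Λ) := by
    intro j hj
    have hjk : j ≤ k := (mem_Icc.mp hj).2
    set Sj := fun y => blockSum45 (oldGeom S.P k j) (PU j) (fun y => oldBonds B.M₁ B.Rcol h j y) ((𝔖 k).Ndeg j) y
      with hSj
    have hS0 : ∀ y, 0 ≤ Sj y := fun y => blockSum45_nonneg _ _ _ _ y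
    have hSb : ∀ y, Sj y ≤ 2 * C * ((8 * (L : ℝ) ^ 2 * B₃ * Z') * g * pg) ^ 2 * ell S.P k j ^ 4 :=
      fun y => h45 j hj y
    -- only blocks of newSites contribute
    have hsplit : ∑ y ∈ oldBlocks B.M₁ B.Rcol h j, Sj y =
        ∑ y ∈ (oldBlocks B.M₁ B.Rcol h j).filter (fun y => y ∈ newSites B.M₁ B.Rcol h j), Sj y := by
      rw [sum_filter]
      refine sum_congr rfl fun y _ => ?_
      by_cases hy : y ∈ newSites B.M₁ B.Rcol h j
      · rw [if_pos hy]
      · rw [if_neg hy, hSj]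
        exact blockSum45_eq_zero_of_not_mem B 𝔖 k h U hy
    have hcard : (((oldBlocks B.M₁ B.Rcol h j).filter (fun y => y ∈ newSites B.M₁ B.Rcol h j)).card : ℝ) ≤
        (L : ℝ) ^ (3 * (k + 1 - j)) * Λ := by
      have h1 : ((oldBlocks B.M₁ B.Rcol h j).filter (fun y => y ∈ newSites B.M₁ B.Rcol h j)).card ≤
          (newSites B.M₁ B.Rcol h j).card := card_le_card fun y hy => (mem_filter.mp hy).2
      have hkP : k + 1 ≤ S.P.m + S.P.K := hk
      have h2 := card_newSites_le (P := S.P) B.M₁ B.Rcol h (j := j) (by omega) hkP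
      have hd : S.P.d = 3 := rfl
      have hPL : S.P.L = L := rfl
      rw [hd, hPL, LamVol_succ_eq_card_lamFin] at h2
      rw [hΛdef]
      exact_mod_cast h1.trans h2
    have hconst0 : 0 ≤ 2 * C * ((8 * (L : ℝ) ^ 2 * B₃ * Z') * g * pg) ^ 2 * ell S.P k j ^ 4 := by
      have := (ell_pos S.P k j).le; positivity
    have hell : (L : ℝ) ^ (3 * (k + 1 - j)) * ell S.P k j ^ 4 = (L : ℝ) ^ 3 * (L : ℝ)⁻¹ ^ (k - j) := by
      unfold ell
      have hPL : (S.P.L : ℝ) = L := rfl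
      rw [hPL, show k + 1 - j = (k - j) + 1 by omega]
      have hL0' : (L : ℝ) ≠ 0 := hL0.ne'
      generalize k - j = m
      rw [show 3 * (m + 1) = 3 * m + 3 by ring, pow_add, ← pow_mul, inv_pow, inv_pow,
        show m * 4 = 3 * m + m by ring, pow_add]
      field_simp
    calc ∑ y ∈ oldBlocks B.M₁ B.Rcol h j, Sj y
        = ∑ y ∈ (oldBlocks B.M₁ B.Rcol h j).filter (fun y => y ∈ newSites B.M₁ B.Rcol h j), Sj y := hsplit
      _ ≤ ∑ _y ∈ (oldBlocks B.M₁ B.Rcol h j).filter (fun y => y ∈ newSites B.M₁ B.Rcol h j),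
            2 * C * ((8 * (L : ℝ) ^ 2 * B₃ * Z') * g * pg) ^ 2 * ell S.P k j ^ 4 := sum_le_sum fun y _ => hSb y
      _ = (((oldBlocks B.M₁ B.Rcol h j).filter (fun y => y ∈ newSites B.M₁ B.Rcol h j)).card : ℝ) *
            (2 * C * ((8 * (L : ℝ) ^ 2 * B₃ * Z') * g * pg) ^ 2 * ell S.P k j ^ 4) := by
          rw [sum_const, nsmul_eq_mul]
      _ ≤ (L : ℝ) ^ (3 * (k + 1 - j)) * Λ * (2 * C * ((8 * (L : ℝ) ^ 2 * B₃ * Z') * g * pg) ^ 2 * ell S.P k j ^ 4) :=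
          mul_le_mul_of_nonneg_right hcard hconst0
      _ = (L : ℝ) ^ (3 * (k + 1 - j)) * ell S.P k j ^ 4 * (2 * C * ((8 * (L : ℝ) ^ 2 * B₃ * Z') * g * pg) ^ 2 * Λ) := by
          ring
      _ = (L : ℝ) ^ 3 * (L : ℝ)⁻¹ ^ (k - j) * (2 * C * ((8 * (L : ℝ) ^ 2 * B₃ * Z') * g * pg) ^ 2 * Λ) := by
          rw [hell]
  -- sum over the scales: the d = 3 power counting
  have hpc : ∑ j ∈ Icc 1 k, (L : ℝ)⁻¹ ^ (k - j) ≤ (L : ℝ) / ((L : ℝ) - 1) := by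
    rw [sum_Icc_pow_sub]
    simpa using B10.powerCounting_d3 (L : ℝ) hL1 k
  have hK0 : 0 ≤ 2 * C * ((8 * (L : ℝ) ^ 2 * B₃ * Z') * g * pg) ^ 2 * Λ := by positivity
  calc |(𝔖 k).PoldIn B.M₁ B.Rcol h U|
      ≤ ∑ j ∈ Icc 1 k, ∑ y ∈ oldBlocks B.M₁ B.Rcol h j,
          blockSum45 (oldGeom S.P k j) (PU j) (fun y => oldBonds B.M₁ B.Rcol h j y) ((𝔖 k).Ndeg j) y :=
        abs_poldIn_le_blockSums B 𝔖 k h U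
    _ ≤ ∑ j ∈ Icc 1 k, (L : ℝ) ^ 3 * (L : ℝ)⁻¹ ^ (k - j) * (2 * C * ((8 * (L : ℝ) ^ 2 * B₃ * Z') * g * pg) ^ 2 * Λ) :=
        sum_le_sum hscale
    _ = (L : ℝ) ^ 3 * (2 * C * ((8 * (L : ℝ) ^ 2 * B₃ * Z') * g * pg) ^ 2 * Λ) * ∑ j ∈ Icc 1 k, (L : ℝ)⁻¹ ^ (k - j) := by
        rw [mul_sum]
        refine sum_congr rfl fun j _ => ?_
        ring
    _ ≤ (L : ℝ) ^ 3 * (2 * C * ((8 * (L : ℝ) ^ 2 * B₃ * Z') * g * pg) ^ 2 * Λ) * ((L : ℝ) / ((L : ℝ) - 1)) :=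
        mul_le_mul_of_nonneg_left hpc (by positivity)
    _ = 2 * C * (8 * (L : ℝ) ^ 2 * B₃ * Z') ^ 2 * ((L : ℝ) ^ 4 / ((L : ℝ) - 1)) * (g * pg) ^ 2 * Λ := by
        simp only [div_eq_mul_inv]
        ring

end OldSlice

/-! ## §4 (46) for the series tower, given the newborn slice; the `LeafSystem.bound46` shape modulo the volume identification -/

section Series

variable {V : Type} [NormedAddCommGroup V] [NormedSpace ℂ V] {Nc : ℕ → ℕ} [∀ k, NeZero (Nc k)]
  (B : TowerBase S G) (𝔖 : ∀ k, StepSeries S G V (Nc k) k) (Cp : ∀ k, PiecesParams S k) (k : ℕ)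

/-- **(46) FOR THE SERIES TOWER AT SCALE `k+1`** (p. 267 L10–12 «Σ_{j=1}^k Σ_{Y_j}|𝒫_j(Y_j, U_k)| ≤ O(1)M₁³g²_{k−1}p²(g_{k−1})|Λ_k|»
one step up: `Pint (k+1) = PoldIn_k + PY_k + PYZ_k`, p1 `withSeries_Pint_succ`): the OLD SLICE from the display (44) about `oldVal`
(`h44`, `hfloor`, smallness — `abs_poldIn_le`), the NEWBORN SLICE as the ONE named input `hnew` («|PY_k + PYZ_k| ≤
C_new·(g_kp(g_k))²·|Ω_{k+1}^{(k+1)}|», (34) p. 264 / (61) p. 271 with (44)–(45)); volume = `#LamFin M₁ Rcol k h` = `|Ω_{k+1}^{(k+1)}(h)|`.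
[cite: Balaban1985UV3, (44)–(46) p.267 + (33)–(34) p.264] -/
theorem abs_pint_succ_le (hk : k + 1 ≤ S.m + S.K) {κ₁ B₃ C Cnew : ℝ} (hC : 0 ≤ C) (hB : 0 ≤ B₃) (hκ₁ : 0 < κ₁)
    (hM : 0 < B.M₁) (hb₀ : 0 ≤ B.b₀) (hg : 0 < S.gk k) (hg1 : S.gk k ≤ 1)
    (h44 : ∀ (h : Hist S.P (k + 1)) (U : GaugeField S.P (k + 1) G), ∀ j ∈ Icc 1 k,
      Bound44 (oldGeom S.P k j) (fun y n c => (𝔖 k).oldVal h U j y n c) κ₁ (B.M₁ : ℝ) (ell S.P k j) (L : ℝ) B₃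
        (S.gk k) (B10.pFun B.b₀ B.p₀ (S.gk k)) C)
    (hfloor : ∀ (h : Hist S.P (k + 1)) (U : GaugeField S.P (k + 1) G), ∀ j ∈ Icc 1 k, ∀ (y : Site S.P j) (n : ℕ)
      (c : Fin n → PBond S.P j), (𝔖 k).oldVal h U j y n c ≠ 0 → 2 ≤ n)
    (hsmall : 8 * (L : ℝ) ^ 2 * B₃ *
        (2 / (κ₁ / B.M₁) * (24 * (48 / (κ₁ / B.M₁ / 2) ^ 3 * Real.exp (κ₁ / B.M₁ / 2 / 2) /
          (1 - Real.exp (-(κ₁ / B.M₁ / 2 / 2)))) * 1)) *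
        S.gk k * B10.pFun B.b₀ B.p₀ (S.gk k) ≤ 1 / 2)
    (hnew : ∀ (h : Hist S.P (k + 1)) (U : GaugeField S.P (k + 1) G),
      |(𝔖 k).PY h U + (𝔖 k).PYZ h U| ≤ Cnew * (S.gk k * B10.pFun B.b₀ B.p₀ (S.gk k)) ^ 2 * (LamFin B.M₁ B.Rcol k h).card)
    (h : Hist S.P (k + 1)) (U : GaugeField S.P (k + 1) G) :
    |(B.withSeries 𝔖 Cp).tower3.toTowerRun.Pint (k + 1) h U| ≤
      (2 * C * (8 * (L : ℝ) ^ 2 * B₃ *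
          (2 / (κ₁ / B.M₁) * (24 * (48 / (κ₁ / B.M₁ / 2) ^ 3 * Real.exp (κ₁ / B.M₁ / 2 / 2) /
            (1 - Real.exp (-(κ₁ / B.M₁ / 2 / 2)))) * 1))) ^ 2 * ((L : ℝ) ^ 4 / ((L : ℝ) - 1)) + Cnew) *
        (S.gk k * B10.pFun B.b₀ B.p₀ (S.gk k)) ^ 2 * (LamFin B.M₁ B.Rcol k h).card := by
  have hold := abs_poldIn_le B 𝔖 k hk hC hB hκ₁ hM hb₀ hg hg1 h44 hfloor hsmall h U
  have hn := hnew h U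
  have hsplit : (B.withSeries 𝔖 Cp).tower3.toTowerRun.Pint (k + 1) h U =
      (𝔖 k).PoldIn B.M₁ B.Rcol h U + ((𝔖 k).PY h U + (𝔖 k).PYZ h U) := by
    show (B.withSeries 𝔖 Cp).Pint (k + 1) h U = _
    rw [withSeries_Pint_succ, add_assoc]
  rw [hsplit]
  refine (abs_add_le _ _).trans ?_
  rw [add_mul, add_mul]
  exact add_le_add hold hn

/-- **(46) in the threshold form** (R-EPS0′): the smallness FROM `g_k ≤ γ₄₆ := gammaOf b₀ p₀ (1/(2·8L²B₃Z′(κ₁/M₁)))`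
(`Thresholds.gammaOf_spec`); `γ₄₆` is the number seat p3 puts into `gammaMin`. [cite: Balaban1985UV3, (45)–(46) p.267] -/
theorem abs_pint_succ_le_gamma (hk : k + 1 ≤ S.m + S.K) {κ₁ B₃ C Cnew : ℝ} (hC : 0 ≤ C) (hB : 0 ≤ B₃) (hκ₁ : 0 < κ₁)
    (hM : 0 < B.M₁) (hb₀ : 0 < B.b₀) (hp₀ : 0 < B.p₀) (hg : 0 < S.gk k) (hg1 : S.gk k ≤ 1)
    (h44 : ∀ (h : Hist S.P (k + 1)) (U : GaugeField S.P (k + 1) G), ∀ j ∈ Icc 1 k,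
      Bound44 (oldGeom S.P k j) (fun y n c => (𝔖 k).oldVal h U j y n c) κ₁ (B.M₁ : ℝ) (ell S.P k j) (L : ℝ) B₃
        (S.gk k) (B10.pFun B.b₀ B.p₀ (S.gk k)) C)
    (hfloor : ∀ (h : Hist S.P (k + 1)) (U : GaugeField S.P (k + 1) G), ∀ j ∈ Icc 1 k, ∀ (y : Site S.P j) (n : ℕ)
      (c : Fin n → PBond S.P j), (𝔖 k).oldVal h U j y n c ≠ 0 → 2 ≤ n)
    (hγ : S.gk k ≤ gammaOf B.b₀ B.p₀ (1 / (2 * (8 * (L : ℝ) ^ 2 * B₃ *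
        (2 / (κ₁ / B.M₁) * (24 * (48 / (κ₁ / B.M₁ / 2) ^ 3 * Real.exp (κ₁ / B.M₁ / 2 / 2) /
          (1 - Real.exp (-(κ₁ / B.M₁ / 2 / 2)))) * 1))))))
    (hnew : ∀ (h : Hist S.P (k + 1)) (U : GaugeField S.P (k + 1) G),
      |(𝔖 k).PY h U + (𝔖 k).PYZ h U| ≤ Cnew * (S.gk k * B10.pFun B.b₀ B.p₀ (S.gk k)) ^ 2 * (LamFin B.M₁ B.Rcol k h).card)
    (h : Hist S.P (k + 1)) (U : GaugeField S.P (k + 1) G) :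
    |(B.withSeries 𝔖 Cp).tower3.toTowerRun.Pint (k + 1) h U| ≤
      (2 * C * (8 * (L : ℝ) ^ 2 * B₃ *
          (2 / (κ₁ / B.M₁) * (24 * (48 / (κ₁ / B.M₁ / 2) ^ 3 * Real.exp (κ₁ / B.M₁ / 2 / 2) /
            (1 - Real.exp (-(κ₁ / B.M₁ / 2 / 2)))) * 1))) ^ 2 * ((L : ℝ) ^ 4 / ((L : ℝ) - 1)) + Cnew) *
        (S.gk k * B10.pFun B.b₀ B.p₀ (S.gk k)) ^ 2 * (LamFin B.M₁ B.Rcol k h).card := by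
  set X : ℝ := 8 * (L : ℝ) ^ 2 * B₃ *
    (2 / (κ₁ / B.M₁) * (24 * (48 / (κ₁ / B.M₁ / 2) ^ 3 * Real.exp (κ₁ / B.M₁ / 2 / 2) /
      (1 - Real.exp (-(κ₁ / B.M₁ / 2 / 2)))) * 1)) with hXdef
  have hM' : (0 : ℝ) < B.M₁ := by exact_mod_cast hM
  have hX0 : 0 ≤ X := by
    rw [hXdef]
    have ha : 0 < κ₁ / (B.M₁ : ℝ) := by positivity
    have h1 : Real.exp (-(κ₁ / B.M₁ / 2 / 2)) < 1 := Real.exp_lt_one_iff.2 (by linarith)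
    have h2 : 0 < 1 - Real.exp (-(κ₁ / B.M₁ / 2 / 2)) := by linarith
    positivity
  refine abs_pint_succ_le B 𝔖 Cp k hk hC hB hκ₁ hM hb₀.le hg hg1 h44 hfloor ?_ hnew h U
  show X * S.gk k * B10.pFun B.b₀ B.p₀ (S.gk k) ≤ 1 / 2
  rcases hX0.eq_or_lt with hX | hX
  · rw [← hX]; norm_num
  · have hσ : 0 ≤ 1 / (2 * X) := by positivity
    have hgp := gammaOf_spec hb₀ hp₀ hσ hg hγ
    calc X * S.gk k * B10.pFun B.b₀ B.p₀ (S.gk k) = X * (S.gk k * B10.pFun B.b₀ B.p₀ (S.gk k)) := by ring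
      _ ≤ X * (1 / (2 * X)) := mul_le_mul_of_nonneg_left hgp hX.le
      _ = 1 / 2 := by field_simp

/-- **`LeafSystem.bound46` SHAPE FOR THE SERIES TOWER** (LEAF-LEDGER B15), from the per-step bound `hstep` (e.g. `abs_pint_succ_le(_gamma)`,
constant `A`) and the VOLUME IDENTIFICATION `hΛ : #LamFin M₁ Rcol k h ≤ Λvol (k+1) h` (true once p1's `LamVol (k+1) h` counts
`Ω_{k+1}^{(k+1)}`, ruling R-LAMVOL); `C46 := A·M₁⁻³` (the `M₁³` of (46) re-inserted, C-B10-1). [cite: Balaban1985UV3, (46) p.267] -/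
theorem bound46_series_of_steps {A : ℝ} (hM : 0 < B.M₁)
    (hstep : ∀ k, k + 1 ≤ S.K → ∀ (h : Hist S.P (k + 1)) (U : GaugeField S.P (k + 1) G),
      |(B.withSeries 𝔖 Cp).tower3.toTowerRun.Pint (k + 1) h U| ≤
        A * (S.gk k * B10.pFun B.b₀ B.p₀ (S.gk k)) ^ 2 * (LamFin B.M₁ B.Rcol k h).card)
    (hA : 0 ≤ A)
    (hΛ : ∀ k, k + 1 ≤ S.K → ∀ (h : Hist S.P (k + 1)),
      ((LamFin B.M₁ B.Rcol k h).card : ℝ) ≤ (B.withSeries 𝔖 Cp).tower3.toTowerRun.Λvol (k + 1) h) :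
    ∀ k, 1 ≤ k → k ≤ (B.withSeries 𝔖 Cp).tower3.toTowerRun.K →
      ∀ (h : (B.withSeries 𝔖 Cp).tower3.toTowerRun.Hist k) (U : (B.withSeries 𝔖 Cp).tower3.toTowerRun.Cfg k),
        |(B.withSeries 𝔖 Cp).tower3.toTowerRun.Pint k h U| ≤
          (A * ((B.M₁ : ℝ)⁻¹) ^ 3) * (B.withSeries 𝔖 Cp).tower3.toTowerRun.M₁ ^ 3 *
            (((B.withSeries 𝔖 Cp).tower3.toTowerRun.g (k - 1)) ^ 2 *
              (B10.pFun (B.withSeries 𝔖 Cp).tower3.toTowerRun.b₀ (B.withSeries 𝔖 Cp).tower3.toTowerRun.p₀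
                ((B.withSeries 𝔖 Cp).tower3.toTowerRun.g (k - 1))) ^ 2) *
            (B.withSeries 𝔖 Cp).tower3.toTowerRun.Λvol k h := by
  intro k hk1 hkK h U
  obtain ⟨k, rfl⟩ : ∃ k', k = k' + 1 := ⟨k - 1, by omega⟩
  have hkK' : k + 1 ≤ S.K := hkK
  have h1 := hstep k hkK' h U
  have h2 := hΛ k hkK' h
  have hM' : (0 : ℝ) < B.M₁ := by exact_mod_cast hM
  show |(B.withSeries 𝔖 Cp).tower3.toTowerRun.Pint (k + 1) h U| ≤
    (A * ((B.M₁ : ℝ)⁻¹) ^ 3) * (B.M₁ : ℝ) ^ 3 * ((S.gk (k + 1 - 1)) ^ 2 * (B10.pFun B.b₀ B.p₀ (S.gk (k + 1 - 1))) ^ 2) *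
      (B.withSeries 𝔖 Cp).tower3.toTowerRun.Λvol (k + 1) h
  rw [Nat.add_sub_cancel]
  have hM3 : (A * ((B.M₁ : ℝ)⁻¹) ^ 3) * (B.M₁ : ℝ) ^ 3 = A := by field_simp
  rw [hM3, ← mul_pow]
  exact h1.trans (mul_le_mul_of_nonneg_left h2 (by positivity))

end Series

end Summit.QuantumFields.Balaban3D.Proofs.Bound46Series

end
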